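import Literature.Analysis.Convexity.AnisotropicPerimeter
import Literature.MathematicalPhysics.StatisticalMechanics.WulffCrystalEmergence
import Literature.MathematicalPhysics.StatisticalMechanics.FlatleyTheil2015FccLatticeLayers
import Literature.MathematicalPhysics.StatisticalMechanics.BarlowTexturedSet
import HarnessLib

/-!
# The `Γ`-limit of the sticky-sphere energy on the fcc and hcp packings: compactness, liminf and
# limsup inequalities (Cicalese–Kreutz–Leonardi 2023, Theorem 2.3)

Topic `Literature/MathematicalPhysics/StatisticalMechanics`; third file on M. Cicalese, L. Kreutz,
G. P. Leonardi, *Emergence of Wulff-crystals from atomistic systems on the FCC and HCP lattices*,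
Comm. Math. Phys. **402** (2023) 2931–2978 = arXiv:2204.12892 [CicaleseKreutzLeonardi2023], after
`StickyWulffConstants.lean` (the convergence of minimum values, constants `∛432`, `(3/2)∛130`) and
`WulffCrystalEmergence.lean` (Theorem 2.3 (i) second part with Lemma 5.16: minimisers converge to the
Wulff crystal; `wulffSet` (22), `phiHcp` (26), `EmpiricalMeasuresConvergeTo`).  Both earlier files list
the `Γ`-CONVERGENCE STATEMENT ITSELF — Theorem 2.3 (i) first part (compactness), (ii) (liminf
inequality), (iii) (limsup inequality) — under "WHAT IS NOT HERE", for want of sets of finite perimeter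
in Mathlib.  This file types it over the tree's distributional vocabulary: De Giorgi's perimeter
(`FccTexturedSet.lean`) and the anisotropic perimeter with constraint body
`Literature.Analysis.Convexity.anisotropicPerimeter K V = sup {∫_V div φ : φ ∈ C¹_c, φ(x) ∈ K}`
(`AnisotropicPerimeter.lean`), which for `K = W̄_ϕ` is the surface energy `∫_{∂*V} ϕ(ν_V) dH²` of the
limit functional (21) — the same rendering as the `Per (W A) S` binding of the venture items
`Summit.Ventures.Crystal3D.Theses.StickyWulffConstant.PolycrystalWulffBound` / `TextureLiminf`.
Cross-ladder literature-typing layer (D-0088 (4)), cell `crystal3d-full`, seat `littype-FC1-2`.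

## Source, as printed (pages of the arXiv text `paper:cicalese2023-emergence-wulff-crystals-from-atomistic-systems-fcc`)

* p. 6: "`x ∈ N(y) ⟺ |x − y| = 1`"; "`E_L(X, A) := Σ_{x ∈ X ∩ A} (12 − #(N(x) ∩ X))` … we can interpret
  the set `X` as the occupancy of the crystal `L`"; "Surface scaling … For `ε > 0` such that
  `ε³ #X → 1` … `G_{L,ε}(X) := ε² Σ_{x ∈ X} (12 − #(N_ε(x) ∩ X))`."
* p. 7, (17)–(18): "`μ_ε := ε³ Σ_{x ∈ X} δ_x`"; "`E_{L,ε}(μ) := G_{L,ε}(X)` if `μ = μ_ε` for some `X ⊂ εL`,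
  `+∞` otherwise"; (19) the homogenised density `ϕ_L`; (21): "`E_L(μ) := ∫_{∂*V} ϕ_L(ν) dH²` if
  `μ = √2 𝓛³⌞V`, `χ_V ∈ BV_loc(ℝ³)`, `+∞` otherwise … `∂*V` denotes the reduced boundary of the set `V`,
  `ν` its outer normal"; "we say that `F_ε` `Γ`-converges to `F` if for all sequences `{ε_j}` converging
  to `0` we have `Γ-lim_j F_{ε_j} = F`."
* p. 4: "`μ_k ⇀* μ` if `lim_k ∫_A ϕ dμ_k = ∫_A ϕ dμ` for all `ϕ ∈ C_c(A)`"; "`Per(V, A) = sup {∫_V div v :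
  v ∈ C_c^∞(A; ℝⁿ), ‖v‖_∞ ≤ 1}`".
* p. 8, (22): `W_ϕ := {ζ ∈ ℝⁿ : ⟨ζ, ν⟩ ≤ ϕ(ν) for all ν ∈ S^{n−1}}`; "`W_ϕ = {ϕ° ≤ 1}`".
* p. 8–9, **Theorem 2.3.** "Let `ε → 0`, and let `E_{L,ε}` and `E_L` be the energy functionals defined in
  (18) and (21), respectively.
  i) (Compactness) Let `{μ_ε}_ε ⊂ M₊(ℝ³)` be such that `sup_{ε>0} E_{L,ε}(μ_ε) < +∞`.  Then there exists
  `V ⊂ ℝ³` such that `χ_V ∈ BV_loc(ℝ³)`, `μ = √2 𝓛³⌞V`, and a subsequence (not relabeled) such that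
  `μ_ε ⇀* μ`. [Furthermore … minimisers: typed in `WulffCrystalEmergence.lean`.]
  ii) (Liminf inequality) Let `μ ∈ M₊(ℝ³)` be such that `μ_ε ⇀* μ`. Then `E_L(μ) ≤ liminf_{ε→0} E_{L,ε}(μ_ε)`.
  iii) (Limsup inequality) Let `μ ∈ M₊(ℝ³)`. Then there exists `{μ_ε}_ε ⊂ M₊(ℝ³)` such that `μ_ε ⇀* μ`
  and `E_L(μ) ≥ liminf_{ε→0} E_{L,ε}(μ_ε)`."  [sic: `liminf` in (iii) as printed.]
* p. 10, Proposition 2.4 (23): `ϕ_FCC(ν) = |ν₁+ν₂| + |ν₁+ν₃| + |ν₂+ν₃| + |ν₁−ν₂| + |ν₁−ν₃| + |ν₂−ν₃|`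
  (= `2·phiFcc`, `FccSurfaceTension.lean`); Proposition 2.5 (26): `ϕ_HCP` (= `2·phiHcp`,
  `WulffCrystalEmergence.lean`); p. 25–26, proof of Theorem 2.3: `L_FCC`, `L_HCP` are admissible
  periodic sets with nearest neighbours at distance `1` and `c_nn ≡ 1`, and the theorem is Theorem 5.14
  (+ Proposition 5.10, Lemma 5.11) for them, `ρ = √2`.

## Rendering

* OCCUPANCIES.  A configuration is an arbitrary subset `X ⊆ L` of the unscaled host (finite or not;
  `X ⊂ εL` of the source is `εX`).  Its excess energy `E_L(X, ℝ³) = Σ_{x∈X} (12 − #(N(x) ∩ X)) ∈ [0, ∞]`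
  is `excessEnergy X` (a `tsum` in `ℝ≥0∞` of the missing-bond counts `missingBonds X x`, with
  `N(x) ∩ X = {y ∈ X : |x − y| = 1}`), and `G_{L,ε}(εX) = ε² E_L(X, ℝ³)` is `scaledEnergy ε X`.  For a
  finite `X` on a host with twelve neighbours this is `2·contactDeficiency X` (`excessEnergy_coe`,
  PROVED) — the paper's units are TWICE the tree's "deficiency units" of `StickyWulffConstants.lean`,
  and correspondingly `ϕ_FCC = 2·phiFcc`, `ϕ_HCP = 2·phiHcp`, `W_{ϕ_L} = 2·W_{φ_L}` and
  `∫_{∂*V} ϕ_L = 2·∫_{∂*V} φ_L`: the limit functional (21) is `2 * anisotropicPerimeter (wulffSet φ_L) V`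
  (`anisotropicPerimeter_smul_left`).
* MEASURES.  `∫ g dμ_ε = ε³ Σ_{x∈X} g(εx)` is `empiricalPairing ε X g` (a `tsum`; a finite sum for
  `g ∈ C_c` and `X ⊆ L`), and "`μ_{ε_k} ⇀* √2 𝓛³⌞V`" is `EmpiricalMeasuresWeakStarTo X ε V` (test
  functions `g ∈ C_c(ℝ³)`, p. 4); for finite configurations it is `EmpiricalMeasuresConvergeTo` of
  `WulffCrystalEmergence.lean` with zero translations (`empiricalMeasuresWeakStarTo_coe_iff`, PROVED).
  "Let `ε → 0`" = an arbitrary sequence `ε_k > 0`, `ε_k → 0`; "a subsequence" = a strictly increasing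
  `φ : ℕ → ℕ`.
* THE LIMIT FUNCTIONAL off its domain.  (21) puts `E_L(μ) = +∞` unless `μ = √2 𝓛³⌞V` with
  `χ_V ∈ BV_loc`.  The statements below quantify over limits of the form `√2 𝓛³⌞V`, `V` measurable:
  for such `V` NOT of locally finite perimeter `anisotropicPerimeter (wulffSet φ_L) V = +∞` as well
  (`W_{φ_L} ⊇ B̄_{√3}`, `mul_perimeter_le_anisotropicPerimeter`), so (ii) then reads `liminf = +∞` as
  printed; and a weak-star limit `μ` of energy-bounded empirical measures not of the form `√2 𝓛³⌞V`
  does not exist by (i) (uniqueness of weak-star limits), which is how (ii) covers general `μ`.  In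
  (iii) the source's recovery sequence for `E_L(μ) = +∞` is `μ_ε := μ` (energy `+∞`), which asserts
  nothing about configurations; the typed (iii) therefore assumes `E_L(μ) < ∞` and then produces
  OCCUPANCIES `X_k ⊆ L`, as the source does (its recovery sequences are empirical measures, (18)).

## Contents (namespace `Literature.MathematicalPhysics.StatisticalMechanics`)

§1 occupancies: `missingBonds`, `excessEnergy`, `scaledEnergy`, `empiricalPairing`,
   `EmpiricalMeasuresWeakStarTo` (definitions with bodies);
§2 bridges to the finite vocabulary (PROVED): `missingBonds_coe`, `sum_card_filter_dist_eq_orderedContacts`,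
   `excessEnergy_coe` (`= 2·contactDeficiency`), `scaledEnergy_coe`, `empiricalPairing_coe`,
   `empiricalMeasuresWeakStarTo_coe_iff`; `card_filter_dist_le_twelve_of_subset_fccLattice` (twelve
   neighbours in `L_FCC`, from `FlatleyTheil2015.ncard_sphere_fccLattice`);
§3 the three clauses of Theorem 2.3 as predicates of a host `L` and a density `φ` (tree units):
   `LatticeEnergyCompactness L`, `LatticeEnergyLiminf L φ`, `LatticeEnergyLimsup L φ`;
§4 NAMED FACTS `CicaleseKreutzLeonardi2023_fccGammaLimit` (host `FlatleyTheil2015.fccLattice` = (8),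
   density `phiFcc` = (23)/2) and `CicaleseKreutzLeonardi2023_hcpGammaLimit` (host `hcpStacking 1 √(2/3)`
   = (9), density `phiHcp` = (26)/2): Theorem 2.3 (i) first part, (ii), (iii);
§5 PROVED corollaries in the cell's vocabulary: `fccGammaLimit_liminf_finset` — for finite
   `X_k ⊂ L_FCC` whose rescaled empirical measures converge to `√2 χ_V`,
   `2·P_{W_{φ_fcc}}(V) ≤ liminf 2 ε_k² D(X_k)` (`D = contactDeficiency`);
   `card_filter_dist_le_twelve_of_subset_barlowStacking` (twelve neighbours in every close-packed
   stacking `barlowStacking 1 √(2/3) s`, from `touching_barlowStacking_eq_image_barlowShell`,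
   `ncard_barlowShell`) and the hcp twin `hcpGammaLimit_liminf_finset`.

WHAT IS NOT HERE: the general periodic-lattice theory of §5 (Definitions 5.1–5.8, Proposition 5.10,
Lemma 5.11, Theorem 5.14 with the cell formula for `ϕ_hom`, Lemma 5.15) — only its two instances
`L_FCC`, `L_HCP` with the explicit densities of Propositions 2.4–2.5, as Theorem 2.3 states them; the
identification `anisotropicPerimeter (wulffSet φ) V = ∫_{∂*V} φ(ν_V) dH²` (see `AnisotropicPerimeter.lean`);
any proof of the named facts (D-0014 facts).
-/

noncomputable section

open scoped Pointwise RealInnerProductSpace ENNReal Topology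
open MeasureTheory Filter Set

namespace Literature.MathematicalPhysics.StatisticalMechanics

open Literature.Barriers.AtomisticToContinuum.FlatleyTheil2015 (fccLattice)
open Literature.Analysis.Convexity (anisotropicPerimeter HasLocallyFinitePerimeter)

/-! ### §1 Occupancies of a host: energy and empirical measures -/

/-- The number of MISSING bonds at `x` in the occupancy `X`: `12 − #(N(x) ∩ X)` with
`N(x) ∩ X = {y ∈ X : |x − y| = 1}` ("the valence of the point `x` with respect to `X`", p. 6; natural
subtraction, exact on a host where every site has at most twelve points at distance `1`).
[cite: CicaleseKreutzLeonardi2023, §2 p. 6 (definition of `E_L(X, A)`)] -/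
def missingBonds (X : Set (EuclideanSpace ℝ (Fin 3))) (x : EuclideanSpace ℝ (Fin 3)) : ℕ :=
  12 - Set.ncard {y | y ∈ X ∧ dist x y = 1}

/-- **The excess (surface) energy of an occupancy** `X ⊆ L`:
`E_L(X, ℝ³) = Σ_{x ∈ X} (12 − #(N(x) ∩ X)) ∈ [0, ∞]` (an infinite occupancy may have finite energy).
[cite: CicaleseKreutzLeonardi2023, §2 p. 6 (`E_L(X, A)` with `A = ℝ³`)] -/
def excessEnergy (X : Set (EuclideanSpace ℝ (Fin 3))) : ℝ≥0∞ :=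
  ∑' x : X, (missingBonds X x : ℝ≥0∞)

/-- **The surface-scaled energy** `G_{L,ε}(εX) = ε² Σ_{x ∈ X} (12 − #(N(x) ∩ X))` of the scaled
occupancy `εX ⊂ εL` (= `E_{L,ε}(μ_ε)`, (18)). [cite: CicaleseKreutzLeonardi2023, §2 p. 6 (`G_{L,ε}`), (18) p. 7] -/
def scaledEnergy (ε : ℝ) (X : Set (EuclideanSpace ℝ (Fin 3))) : ℝ≥0∞ :=
  ENNReal.ofReal (ε ^ 2) * excessEnergy X

/-- **The rescaled empirical measure of `εX` paired with a test function:** `∫ g dμ_ε = ε³ Σ_{x∈X} g(εx)`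
for `μ_ε = ε³ Σ_{x ∈ εX} δ_x` (17) (a `tsum`; for `g ∈ C_c(ℝ³)` and `X` in a host only finitely many terms
are non-zero). [cite: CicaleseKreutzLeonardi2023, (17) p. 7] -/
def empiricalPairing (ε : ℝ) (X : Set (EuclideanSpace ℝ (Fin 3))) (g : EuclideanSpace ℝ (Fin 3) → ℝ) : ℝ :=
  ε ^ 3 * ∑' x : X, g (ε • (x : EuclideanSpace ℝ (Fin 3)))

/-- **`μ_{ε_k}(X_k) ⇀* √2 𝓛³⌞V`**: the rescaled empirical measures of the occupancies `ε_k X_k`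
converge weakly-star (against `C_c(ℝ³)`, p. 4) to `√2 χ_V 𝓛³`: `ε_k³ Σ_{x∈X_k} g(ε_k x) → √2 ∫_V g` for
every continuous compactly supported `g`. [cite: CicaleseKreutzLeonardi2023, p. 4 (weak star), (17)
p. 7, Theorem 2.3 p. 8–9] -/
def EmpiricalMeasuresWeakStarTo (X : ℕ → Set (EuclideanSpace ℝ (Fin 3))) (ε : ℕ → ℝ)
    (V : Set (EuclideanSpace ℝ (Fin 3))) : Prop :=
  ∀ g : EuclideanSpace ℝ (Fin 3) → ℝ, Continuous g → HasCompactSupport g →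
    Tendsto (fun k => empiricalPairing (ε k) (X k) g) atTop (𝓝 (Real.sqrt 2 * ∫ y in V, g y))

/-! ### §2 Bridges to the finite-configuration vocabulary -/

/-- On a finite configuration the missing-bond count is `12 − #{y ∈ X : |x − y| = 1}` as a `Finset`
cardinality. [cite: CicaleseKreutzLeonardi2023, §2 p. 6] -/
theorem missingBonds_coe (X : Finset (EuclideanSpace ℝ (Fin 3))) (x : EuclideanSpace ℝ (Fin 3)) :
    missingBonds (↑X) x = 12 - (X.filter fun y => dist x y = 1).card := by
  rw [missingBonds, ← Set.ncard_coe_finset (X.filter fun y => dist x y = 1), Finset.coe_filter]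
  rfl

/-- `Σ_{x∈X} #{y ∈ X : |x − y| = 1} = orderedContacts X` (the number of ordered contact pairs).
[cite: CicaleseKreutzLeonardi2023, §1 (2) and §2 p. 6] -/
theorem sum_card_filter_dist_eq_orderedContacts (X : Finset (EuclideanSpace ℝ (Fin 3))) :
    ∑ x ∈ X, (X.filter fun y => dist x y = 1).card = orderedContacts X := by
  rw [orderedContacts, Finset.card_filter, Finset.sum_product]
  refine Finset.sum_congr rfl fun x _ => ?_
  rw [Finset.card_filter]

/-- **Paper units = twice the deficiency units:** for a finite configuration in which every point has
at most twelve points at distance `1` (e.g. any subset of `L_FCC` or `L_HCP`),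
`Σ_{x∈X} (12 − #(N(x) ∩ X)) = 12·#X − orderedContacts X = 2·contactDeficiency X`.
[cite: CicaleseKreutzLeonardi2023, §2 p. 6 (`G_{L,ε}`); see `StickyWulffConstants.lean`, Rendering] -/
theorem excessEnergy_coe (X : Finset (EuclideanSpace ℝ (Fin 3)))
    (h12 : ∀ x ∈ X, (X.filter fun y => dist x y = 1).card ≤ 12) :
    excessEnergy (↑X) = ENNReal.ofReal (2 * contactDeficiency X) := by
  rw [excessEnergy, Finset.tsum_subtype' X (fun x => (missingBonds (↑X) x : ℝ≥0∞))]
  simp_rw [missingBonds_coe]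
  rw [← Nat.cast_sum, ← ENNReal.ofReal_natCast]
  congr 1
  rw [Nat.cast_sum, Finset.sum_congr rfl fun x hx => Nat.cast_sub (h12 x hx), Finset.sum_sub_distrib,
    Finset.sum_const, nsmul_eq_mul, ← Nat.cast_sum, sum_card_filter_dist_eq_orderedContacts,
    contactDeficiency]
  push_cast
  ring

/-- `G_{L,ε}(εX) = 2 ε² D(X)` for a finite configuration with at most twelve neighbours per point.
[cite: CicaleseKreutzLeonardi2023, §2 p. 6 (`G_{L,ε}`)] -/
theorem scaledEnergy_coe (ε : ℝ) (X : Finset (EuclideanSpace ℝ (Fin 3)))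
    (h12 : ∀ x ∈ X, (X.filter fun y => dist x y = 1).card ≤ 12) :
    scaledEnergy ε (↑X) = ENNReal.ofReal (2 * (ε ^ 2 * contactDeficiency X)) := by
  rw [scaledEnergy, excessEnergy_coe X h12, ← ENNReal.ofReal_mul (sq_nonneg ε)]
  ring_nf

/-- On a finite configuration the pairing is the finite sum `ε³ Σ_{x∈X} g(εx)`.
[cite: CicaleseKreutzLeonardi2023, (17) p. 7] -/
theorem empiricalPairing_coe (ε : ℝ) (X : Finset (EuclideanSpace ℝ (Fin 3)))
    (g : EuclideanSpace ℝ (Fin 3) → ℝ) :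
    empiricalPairing ε (↑X) g = ε ^ 3 * ∑ x ∈ X, g (ε • x) := by
  rw [empiricalPairing, Finset.tsum_subtype' X (fun x => g (ε • x))]

/-- For finite configurations, `EmpiricalMeasuresWeakStarTo` is `EmpiricalMeasuresConvergeTo` of
`WulffCrystalEmergence.lean` with zero translations, limit set `V` and density `√2`.
[cite: CicaleseKreutzLeonardi2023, (17) p. 7, p. 4] -/
theorem empiricalMeasuresWeakStarTo_coe_iff (X : ℕ → Finset (EuclideanSpace ℝ (Fin 3))) (ε : ℕ → ℝ)
    (V : Set (EuclideanSpace ℝ (Fin 3))) :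
    EmpiricalMeasuresWeakStarTo (fun k => ↑(X k)) ε V ↔
      EmpiricalMeasuresConvergeTo X ε (fun _ => 0) V (Real.sqrt 2) := by
  simp only [EmpiricalMeasuresWeakStarTo, EmpiricalMeasuresConvergeTo, empiricalPairing_coe, sub_zero]

/-- **Twelve neighbours in `L_FCC`:** a point of a configuration `X ⊆ L_FCC` has at most twelve points
of `X` at distance `1` (`#(L_FCC ∩ S(x, 1)) = 12`, `FlatleyTheil2015.ncard_sphere_fccLattice`).
[cite: CicaleseKreutzLeonardi2023, §1 p. 2 ("the minimal energy per atom is `−k(3) = −12`") and §2 p. 6] -/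
theorem card_filter_dist_le_twelve_of_subset_fccLattice {X : Finset (EuclideanSpace ℝ (Fin 3))}
    (hX : (↑X : Set (EuclideanSpace ℝ (Fin 3))) ⊆ fccLattice) {x : EuclideanSpace ℝ (Fin 3)}
    (hx : x ∈ X) : (X.filter fun y => dist x y = 1).card ≤ 12 := by
  have h12 := (FlatleyTheil2015.ncard_sphere_fccLattice (hX (Finset.mem_coe.2 hx))).1
  have hsub : (↑(X.filter fun y => dist x y = 1) : Set (EuclideanSpace ℝ (Fin 3))) ⊆
      fccLattice ∩ Metric.sphere x 1 := by
    intro y hy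
    rw [Finset.coe_filter] at hy
    exact ⟨hX hy.1, by rw [Metric.mem_sphere, dist_comm]; exact hy.2⟩
  have hfin : (fccLattice ∩ Metric.sphere x 1).Finite := Set.finite_of_ncard_ne_zero (by rw [h12]; norm_num)
  rw [← Set.ncard_coe_finset, ← h12]
  exact Set.ncard_le_ncard hsub hfin

/-! ### §3 The three clauses of Theorem 2.3, for a host `L` and a density `φ` (tree units) -/

/-- **Theorem 2.3 (i), first part (Compactness), for the host `L`:** for every sequence `ε_k > 0`,
`ε_k → 0`, and occupancies `X_k ⊆ L` with `sup_k G_{L,ε_k}(ε_k X_k) < +∞`, there are a measurable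
`V ⊆ ℝ³` with `χ_V ∈ BV_loc(ℝ³)` (`HasLocallyFinitePerimeter`) and a subsequence along which the rescaled
empirical measures converge weakly-star to `√2 𝓛³⌞V`.
[cite: CicaleseKreutzLeonardi2023, Theorem 2.3 (i) p. 8] -/
def LatticeEnergyCompactness (L : Set (EuclideanSpace ℝ (Fin 3))) : Prop :=
  ∀ (ε : ℕ → ℝ) (X : ℕ → Set (EuclideanSpace ℝ (Fin 3))), (∀ k, 0 < ε k) → Tendsto ε atTop (𝓝 0) →
    (∀ k, X k ⊆ L) → (⨆ k, scaledEnergy (ε k) (X k)) < ∞ →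
      ∃ V : Set (EuclideanSpace ℝ (Fin 3)), HasLocallyFinitePerimeter V ∧
        ∃ φ : ℕ → ℕ, StrictMono φ ∧ EmpiricalMeasuresWeakStarTo (X ∘ φ) (ε ∘ φ) V

/-- **Theorem 2.3 (ii) (Liminf inequality), for the host `L` with density `φ` in deficiency units**
(`ϕ_L = 2φ`): whenever `μ_{ε_k}(X_k) ⇀* √2 𝓛³⌞V` (`X_k ⊆ L`, `V` measurable),
`E_L(√2 𝓛³⌞V) = ∫_{∂*V} ϕ_L(ν) dH² = 2·P_{W_φ}(V) ≤ liminf_k G_{L,ε_k}(ε_k X_k)` — in `[0, ∞]`, both sides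
being `+∞` when `χ_V ∉ BV_loc` (module docstring, Rendering).
[cite: CicaleseKreutzLeonardi2023, Theorem 2.3 (ii) p. 9; (21) p. 7; (22) p. 8] -/
def LatticeEnergyLiminf (L : Set (EuclideanSpace ℝ (Fin 3))) (φ : EuclideanSpace ℝ (Fin 3) → ℝ) : Prop :=
  ∀ (ε : ℕ → ℝ) (X : ℕ → Set (EuclideanSpace ℝ (Fin 3))) (V : Set (EuclideanSpace ℝ (Fin 3))),
    (∀ k, 0 < ε k) → Tendsto ε atTop (𝓝 0) → (∀ k, X k ⊆ L) → MeasurableSet V →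
    EmpiricalMeasuresWeakStarTo X ε V →
      2 * anisotropicPerimeter (wulffSet φ) V ≤ liminf (fun k => scaledEnergy (ε k) (X k)) atTop

/-- **Theorem 2.3 (iii) (Limsup inequality, printed with `liminf`), for the host `L` with density `φ` in
deficiency units:** for every sequence `ε_k > 0`, `ε_k → 0` and every measurable `V` with
`E_L(√2 𝓛³⌞V) = 2·P_{W_φ}(V) < ∞` there are occupancies `X_k ⊆ L` with `μ_{ε_k}(X_k) ⇀* √2 𝓛³⌞V` and
`liminf_k G_{L,ε_k}(ε_k X_k) ≤ E_L(√2 𝓛³⌞V)` (for `E_L(μ) = +∞` the printed recovery sequence is `μ_ε = μ`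
and says nothing about occupancies; module docstring, Rendering).
[cite: CicaleseKreutzLeonardi2023, Theorem 2.3 (iii) p. 9; (21) p. 7; (22) p. 8] -/
def LatticeEnergyLimsup (L : Set (EuclideanSpace ℝ (Fin 3))) (φ : EuclideanSpace ℝ (Fin 3) → ℝ) : Prop :=
  ∀ (ε : ℕ → ℝ) (V : Set (EuclideanSpace ℝ (Fin 3))), (∀ k, 0 < ε k) → Tendsto ε atTop (𝓝 0) →
    MeasurableSet V → anisotropicPerimeter (wulffSet φ) V < ∞ →
      ∃ X : ℕ → Set (EuclideanSpace ℝ (Fin 3)), (∀ k, X k ⊆ L) ∧ EmpiricalMeasuresWeakStarTo X ε V ∧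
        liminf (fun k => scaledEnergy (ε k) (X k)) atTop ≤ 2 * anisotropicPerimeter (wulffSet φ) V

/-! ### §4 The named facts -/

/-- **Cicalese–Kreutz–Leonardi 2023, Theorem 2.3 ((i) compactness, (ii) liminf, (iii) limsup) on the
fcc lattice, NAMED FACT.**  For `L_FCC = span_ℤ{(0,1,1)/√2, (1,0,1)/√2, (1,1,0)/√2}` (8) and the surface
scaling `G_{L,ε}(εX) = ε² Σ_{x∈X}(12 − #(N(x) ∩ X))`, with the weak-star topology of `M₊(ℝ³)`:
(i) energy-bounded sequences of rescaled empirical measures have subsequences converging to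
`√2 𝓛³⌞V`, `χ_V ∈ BV_loc(ℝ³)`; (ii) along any `μ_{ε_k}(X_k) ⇀* √2 𝓛³⌞V`,
`∫_{∂*V} ϕ_FCC(ν) dH² ≤ liminf G`; (iii) every `√2 𝓛³⌞V` of finite energy is the weak-star limit of
rescaled empirical measures of occupancies with `liminf G ≤ ∫_{∂*V} ϕ_FCC(ν) dH²`; here
`ϕ_FCC = 2·phiFcc` is the density (23) of Proposition 2.4 and `∫_{∂*V} ϕ_FCC(ν_V) dH²` is rendered as
`2·anisotropicPerimeter (wulffSet phiFcc) V` (distributional form, `AnisotropicPerimeter.lean`).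
[cite: CicaleseKreutzLeonardi2023, Theorem 2.3 (i)–(iii) p. 8–9; Proposition 2.4 (23) p. 10; (8) p. 5; (21)–(22) p. 7–8] -/
def CicaleseKreutzLeonardi2023_fccGammaLimit : Prop :=
  LatticeEnergyCompactness fccLattice ∧ LatticeEnergyLiminf fccLattice phiFcc ∧
    LatticeEnergyLimsup fccLattice phiFcc

/-- **Cicalese–Kreutz–Leonardi 2023, Theorem 2.3 ((i) compactness, (ii) liminf, (iii) limsup) on the
hcp packing, NAMED FACT.**  The same three clauses for `L_HCP = span_ℤ{e₁,e₂,e₃} ∪ (span_ℤ{e₁,e₂,e₃} + v₁)`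
(9) `= hcpStacking 1 √(2/3)`, with the density `ϕ_HCP = 2·phiHcp` of Proposition 2.5 (26) ("`W_HCP` is a
truncated elongated hexagonal bipyramid") and `∫_{∂*V} ϕ_HCP(ν_V) dH²` rendered as
`2·anisotropicPerimeter (wulffSet phiHcp) V`.
[cite: CicaleseKreutzLeonardi2023, Theorem 2.3 (i)–(iii) p. 8–9; Proposition 2.5 (26) p. 10; (9) p. 5; (21)–(22) p. 7–8] -/
def CicaleseKreutzLeonardi2023_hcpGammaLimit : Prop :=
  LatticeEnergyCompactness (hcpStacking 1 (√(2 / 3))) ∧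
    LatticeEnergyLiminf (hcpStacking 1 (√(2 / 3))) phiHcp ∧
    LatticeEnergyLimsup (hcpStacking 1 (√(2 / 3))) phiHcp

/-! ### §5 The liminf inequality for finite fcc clusters, in the cell's vocabulary (PROVED corollary) -/

/-- **Corollary (PROVED from the fcc named fact): the `Γ`-liminf inequality for finite clusters on
`L_FCC` in deficiency units.**  If finite configurations `X_k ⊂ L_FCC` and scales `ε_k > 0`, `ε_k → 0`
have rescaled empirical measures `ε_k³ Σ_{x∈X_k} δ_{ε_k x} ⇀* √2 χ_V 𝓛³` (`EmpiricalMeasuresConvergeTo`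
with zero translations), then `2·P_{W_{φ_fcc}}(V) ≤ liminf_k 2 ε_k² D(X_k)`, `D = contactDeficiency`
(Theorem 2.3 (ii) with `G_{L,ε}(εX) = 2ε²D(X)`).
[cite: CicaleseKreutzLeonardi2023, Theorem 2.3 (ii) p. 9] -/
theorem fccGammaLimit_liminf_finset (h : CicaleseKreutzLeonardi2023_fccGammaLimit)
    (X : ℕ → Finset (EuclideanSpace ℝ (Fin 3))) (ε : ℕ → ℝ) (V : Set (EuclideanSpace ℝ (Fin 3)))
    (hε : ∀ k, 0 < ε k) (hε0 : Tendsto ε atTop (𝓝 0))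
    (hX : ∀ k, (↑(X k) : Set (EuclideanSpace ℝ (Fin 3))) ⊆ fccLattice) (hV : MeasurableSet V)
    (hconv : EmpiricalMeasuresConvergeTo X ε (fun _ => 0) V (Real.sqrt 2)) :
    2 * anisotropicPerimeter (wulffSet phiFcc) V ≤
      liminf (fun k => ENNReal.ofReal (2 * ((ε k) ^ 2 * contactDeficiency (X k)))) atTop := by
  have hli := h.2.1 ε (fun k => ↑(X k)) V hε hε0 hX hV
    ((empiricalMeasuresWeakStarTo_coe_iff X ε V).2 hconv)
  have hfun : (fun k => scaledEnergy (ε k) ↑(X k)) =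
      fun k => ENNReal.ofReal (2 * ((ε k) ^ 2 * contactDeficiency (X k))) :=
    funext fun k => scaledEnergy_coe (ε k) (X k)
      (fun x hx => card_filter_dist_le_twelve_of_subset_fccLattice (hX k) hx)
  rwa [hfun] at hli

/-- **Twelve neighbours in every close-packed stacking:** a point of a configuration
`X ⊆ barlowStacking 1 √(2/3) s` (`s` a Hägg sequence; `s` alternating = `L_HCP`, constant = fcc) has at
most twelve points of `X` at distance `1` (the touching balls of a site form a translated `barlowShell`,
of cardinality `12`: `touching_barlowStacking_eq_image_barlowShell`, `ncard_barlowShell`).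
[cite: CicaleseKreutzLeonardi2023, §1 p. 2 ("the minimal energy per atom is `−k(3) = −12`") and §2 p. 6] -/
theorem card_filter_dist_le_twelve_of_subset_barlowStacking {s : ℤ → ℤ} (hs : IsHaggSeq s)
    {X : Finset (EuclideanSpace ℝ (Fin 3))}
    (hX : (↑X : Set (EuclideanSpace ℝ (Fin 3))) ⊆ barlowStacking 1 (Real.sqrt (2 / 3)) s)
    {x : EuclideanSpace ℝ (Fin 3)} (hx : x ∈ X) : (X.filter fun y => dist x y = 1).card ≤ 12 := by
  obtain ⟨k, i, j, rfl⟩ := mem_barlowStacking_iff.1 (hX (Finset.mem_coe.2 hx))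
  have hσ : ((s k : ℤ) : ℝ) = 1 ∨ ((s k : ℤ) : ℝ) = -1 := by
    rcases hs k with h | h <;> simp [h]
  have hτ : -((s (k - 1) : ℤ) : ℝ) = 1 ∨ -((s (k - 1) : ℤ) : ℝ) = -1 := by
    rcases hs (k - 1) with h | h <;> simp [h]
  have h12 : Set.ncard {y | y ∈ barlowStacking 1 (Real.sqrt (2 / 3)) s ∧
      dist y (barlowPos 1 (Real.sqrt (2 / 3)) s k i j) = 1} = 12 := by
    rw [touching_barlowStacking_eq_image_barlowShell hs k i j,
      Set.ncard_image_of_injective _ (add_right_injective _), ncard_barlowShell hσ hτ]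
  have hsub : (↑(X.filter fun y => dist (barlowPos 1 (Real.sqrt (2 / 3)) s k i j) y = 1) :
        Set (EuclideanSpace ℝ (Fin 3))) ⊆
      {y | y ∈ barlowStacking 1 (Real.sqrt (2 / 3)) s ∧
        dist y (barlowPos 1 (Real.sqrt (2 / 3)) s k i j) = 1} := by
    intro y hy
    rw [Finset.coe_filter] at hy
    exact ⟨hX hy.1, by rw [dist_comm]; exact hy.2⟩
  have hfin : {y | y ∈ barlowStacking 1 (Real.sqrt (2 / 3)) s ∧
      dist y (barlowPos 1 (Real.sqrt (2 / 3)) s k i j) = 1}.Finite :=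
    Set.finite_of_ncard_ne_zero (by rw [h12]; norm_num)
  rw [← Set.ncard_coe_finset, ← h12]
  exact Set.ncard_le_ncard hsub hfin

/-- **Corollary (PROVED from the hcp named fact): the `Γ`-liminf inequality for finite clusters on
`L_HCP = hcpStacking 1 √(2/3)` in deficiency units** — the hcp twin of `fccGammaLimit_liminf_finset`
(density `φ_hcp = ϕ_HCP/2`, (26)). [cite: CicaleseKreutzLeonardi2023, Theorem 2.3 (ii) p. 9; Proposition 2.5 (26) p. 10] -/
theorem hcpGammaLimit_liminf_finset (h : CicaleseKreutzLeonardi2023_hcpGammaLimit)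
    (X : ℕ → Finset (EuclideanSpace ℝ (Fin 3))) (ε : ℕ → ℝ) (V : Set (EuclideanSpace ℝ (Fin 3)))
    (hε : ∀ k, 0 < ε k) (hε0 : Tendsto ε atTop (𝓝 0))
    (hX : ∀ k, (↑(X k) : Set (EuclideanSpace ℝ (Fin 3))) ⊆ hcpStacking 1 (√(2 / 3)))
    (hV : MeasurableSet V) (hconv : EmpiricalMeasuresConvergeTo X ε (fun _ => 0) V (Real.sqrt 2)) :
    2 * anisotropicPerimeter (wulffSet phiHcp) V ≤
      liminf (fun k => ENNReal.ofReal (2 * ((ε k) ^ 2 * contactDeficiency (X k)))) atTop := by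
  have hli := h.2.1 ε (fun k => ↑(X k)) V hε hε0 hX hV
    ((empiricalMeasuresWeakStarTo_coe_iff X ε V).2 hconv)
  have hfun : (fun k => scaledEnergy (ε k) ↑(X k)) =
      fun k => ENNReal.ofReal (2 * ((ε k) ^ 2 * contactDeficiency (X k))) :=
    funext fun k => scaledEnergy_coe (ε k) (X k)
      (fun x hx => card_filter_dist_le_twelve_of_subset_barlowStacking isHaggSeq_alternating (hX k) hx)
  rwa [hfun] at hli

end Literature.MathematicalPhysics.StatisticalMechanics

end
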